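import Mathlib
import Literature.Combinatorics.Optimization.SosPseudoDensityDuality
import Literature.Combinatorics.Optimization.LPRelaxationsMaxCSP
import Literature.Computability.Complexity.FourierDegree

/-!
# Pseudo-densities in the Fourier–Walsh basis: degree ⇔ Fourier degree, Fact 6.3 of Lee–Raghavendra–Steurer, truncation

Bridges the cube vocabulary of the psd-rank files (`HasDegreeLE`, `cubeExpect`, `IsPseudoDensity`,
`Literature/Combinatorics/Optimization/PatternMatrixPsdRank.lean`: "degree `≤ k`" = agrees on
`{0,1}^m` with a real polynomial of total degree `≤ k`) with the tree's Fourier–Walsh analysis on the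
cube (`Literature/Computability/Complexity/BooleanFourier.lean`, `FourierDegree.lean`: characters
`walsh S x = ∏_{i∈S} (−1)^{x_i}`, coefficients `cubeFourierCoeff g S = E_x g(x) χ_S(x)`, inversion,
orthogonality, `fourierDegree`), and proves with it the two Fourier facts that the proof of
Lee–Raghavendra–Steurer's Theorem 6.4 uses [LeeRaghavendraSteurer2015, §6.2, p. 25–26 of
arXiv:1411.6317]:

* **the dictionary** `HasDegreeLE k g ↔ (ĝ(S) = 0 for |S| > k) ↔ fourierDegree g ≤ k`
  (`hasDegreeLE_iff_cubeFourierCoeff_eq_zero`, `hasDegreeLE_iff_fourierDegree_le`): a monomial of a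
  polynomial of total degree `≤ k` depends on `≤ k` coordinates, so its coefficients vanish on larger
  sets (`cubeFourierCoeff_piecewise_eq_zero`); conversely `χ_S = ∏_{i∈S}(1 − 2x_i)` has degree `|S|`;
* **Fact 6.3** (p. 25): "For every positive even integer `d`, every degree-`d` pseudo-density
  `D : {0,1}^m → ℝ` and every subset `α ⊆ [m]`, `|α| ≤ d`, we have `|E_x D(x) χ_α(x)| ≤ 1`."
  (`IsPseudoDensity.abs_cubeFourierCoeff_le_one`; printed proof: `χ_α = χ_A χ_B` with
  `|A|, |B| ≤ d/2`, `E D (χ_A ∓ χ_B)² ≥ 0`; stated for all `d` with `|α| ≤ 2⌊d/2⌋`, which is `d` for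
  even `d`);
* **the truncation step** (§6.1 p. 24: "all the constraints on the pseudodensity `D` correspond to
  inner products with functions of degree at most `d`. Hence, without loss of generality, we may assume
  `deg(D) ≤ d`", and p. 26: "`D(x) = Σ_{|α| ≤ d(n)} E_x[D(x)χ_α(x)] χ_α(x)` … hence
  `‖D‖_∞ ≤ Σ_{i=0}^{d(n)} C(n,i)`"): `fourierTruncate ℓ D = Σ_{|S| ≤ ℓ} D̂(S) χ_S` pairs like `D`
  with every function of degree `≤ ℓ` (`cubeExpect_fourierTruncate_mul`), is again a degree-`d`
  pseudo-density when `ℓ ≥ 2⌊d/2⌋` (`isPseudoDensity_fourierTruncate`), and for `ℓ ≤ 2⌊d/2⌋`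
  satisfies `|fourierTruncate ℓ D (x)| ≤ #{S ⊆ [m] : |S| ≤ ℓ}` (`IsPseudoDensity.abs_fourierTruncate_le`).

Everything here is PROVED (finite sums); no named facts.  What remains of the printed proof of
Thm 6.4 (`LeeRaghavendraSteurer2015_thm64_repaired`, `SDPRelaxationsMaxCSP.lean`) after this file
and `SosPseudoDensityDuality.lean` is Theorem 3.8 itself (`LeeRaghavendraSteurer2015_thm38`) and the
final arithmetic: the append at the end packages everything before Theorem 3.8 as
`LeeRaghavendraSteurer2015_thm64_reduction` (instance with `opt ≤ s` + pseudo-density of degree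
`≤ 2⌊d/2⌋` with margin `ε` and `‖·‖_∞ ≤ 1 + n^{2⌊d/2⌋}`, via `Σ_{i ≤ ℓ} C(n,i) ≤ 1 + n^ℓ`,
`sum_range_choose_le_one_add_pow`), and records the trivial range of the conclusion
(`not_hasPsdFactorization_cspMatrix_zero`).  (`LPRelaxationsMaxCSP.lean` is imported for
`CSPInstance.hasDegreeLE_val`, `deg ℑ ≤ k`.)

**Second append: Theorem 6.4 from Theorem 3.8.**  The closing arithmetic (`thm38_bound_ge`: for
`24 ≤ d ≤ n`, `‖D‖_∞ ≤ B ≤ 2n^d`, `N ≥ n^{4d}` and `log n` beyond an explicit constant, the bound of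
Thm 3.8 is `≥ 2 n^{d²/8}`, by taking logarithms) and the assembled derivation
`LeeRaghavendraSteurer2015_thm64_repaired_of_thm38 :
LeeRaghavendraSteurer2015_thm38 → LeeRaghavendraSteurer2015_thm64_repaired` — the printed proof of
Thm 6.4 (p. 26) formalised end to end modulo the typed Theorem 3.8 (small `n` are absorbed into the
constant `K`, where only `r = 0` has to be excluded).

**Third append: Theorem 1.6 from Theorem 3.8** (`LeeRaghavendraSteurer2015_thm16_of_thm38 :
LeeRaghavendraSteurer2015_thm38 → LeeRaghavendraSteurer2015_thm16`, the proof of Thm 6.2, §6.2 p. 25,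
with Prop. 1.13 `AchievesApprox.hasPsdFactorization` in place of Prop. 6.1): an achieving subspace
of dimension `≤ α (n/log n)^{d/4}` would give a psd factorisation of the pattern matrix of
`f = (c − ℑ₀)/c` (`HasPsdFactorization.const_mul`) below the Thm 3.8 bound `C (n/log n)^{d/2}`
built from the §2 pseudo-density; degenerate cases (a value above `c`, `d = 0`, constant `ℑ₀`)
are treated directly.
-/

noncomputable section

open Finset
open scoped MatrixOrder
open Literature.Probability.RandomGraphs.LowDegree (walsh sgn)
open Literature.Computability.Complexity.LowDegree (cubeFourierCoeff sum_cubeFourierCoeff_mul_walsh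
  sum_walsh_mul_walsh_index cubeFourierCoeff_piecewise_eq_zero)
open Literature.Computability.Complexity (fourierDegree card_le_fourierDegree
  cubeFourierCoeff_eq_zero_of_lt)

namespace Literature.Combinatorics.Optimization

variable {m : ℕ}

/-! ### The dictionary `cubeExpect` / `cubeFourierCoeff`, linearity -/

/-- `E_x g(x) χ_S(x)` is the Fourier–Walsh coefficient `ĝ(S)`. [cite: LeeRaghavendraSteurer2015, Thm 6.4 proof (p. 26: "E_x[D(x) χ_α(x)]")] -/
theorem cubeExpect_mul_walsh (g : (Fin m → Bool) → ℝ) (S : Finset (Fin m)) :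
    cubeExpect (fun x => g x * walsh S x) = cubeFourierCoeff g S := rfl

/-- Linearity of `ĝ(S)` in `g`: finite linear combinations. [cite: LeeRaghavendraSteurer2015, Thm 6.4 proof (p. 26)] -/
theorem cubeFourierCoeff_sum_mul {ι : Type*} (s : Finset ι) (a : ι → ℝ)
    (g : ι → (Fin m → Bool) → ℝ) (S : Finset (Fin m)) :
    cubeFourierCoeff (fun x => ∑ i ∈ s, a i * g i x) S = ∑ i ∈ s, a i * cubeFourierCoeff (g i) S := by
  unfold Literature.Computability.Complexity.LowDegree.cubeFourierCoeff
  have : ∀ x : Fin m → Bool, (∑ i ∈ s, a i * g i x) * walsh S x = ∑ i ∈ s, a i * (g i x * walsh S x) := by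
    intro x; rw [Finset.sum_mul]; exact sum_congr rfl fun i _ => by ring
  simp_rw [this, Finset.sum_div]
  rw [Finset.sum_comm]
  refine sum_congr rfl fun i _ => ?_
  rw [Finset.mul_sum]
  exact sum_congr rfl fun x _ => by ring

/-! ### Characters are low-degree polynomials -/

/-- `χ_S(x) = ∏_{i∈S} (1 − 2 x_i)` on the cube: `χ_S` has degree `≤ |S|`.
[cite: LeeRaghavendraSteurer2015, Fact 6.3 proof (p. 25: "deg(p) ≤ d/2" for p = χ_A − χ_B)] -/
theorem hasDegreeLE_walsh (S : Finset (Fin m)) : HasDegreeLE S.card (walsh S) := by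
  classical
  refine ⟨∏ i ∈ S, (1 - 2 * MvPolynomial.X i), ?_, fun x => ?_⟩
  · refine (MvPolynomial.totalDegree_finsetProd _ _).trans ?_
    calc ∑ i ∈ S, (1 - 2 * MvPolynomial.X i : MvPolynomial (Fin m) ℝ).totalDegree
        ≤ ∑ _i ∈ S, 1 := by
          refine sum_le_sum fun i _ => (MvPolynomial.totalDegree_sub _ _).trans (max_le (by simp) ?_)
          refine (MvPolynomial.totalDegree_mul _ _).trans ?_
          have h2 : (2 : MvPolynomial (Fin m) ℝ) = MvPolynomial.C 2 := by simp [map_ofNat]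
          rw [h2, MvPolynomial.totalDegree_C, zero_add]
          exact le_of_eq (MvPolynomial.totalDegree_X _)
      _ = S.card := by simp
  · rw [map_prod]
    unfold Literature.Probability.RandomGraphs.LowDegree.walsh
    refine prod_congr rfl fun i _ => ?_
    cases hx : x i
    · simp [cubePoint, hx, Literature.Probability.RandomGraphs.LowDegree.sgn]
    · norm_num [cubePoint, hx, Literature.Probability.RandomGraphs.LowDegree.sgn]

/-- `χ_S` has degree `≤ k` whenever `|S| ≤ k`. [cite: LeeRaghavendraSteurer2015, Fact 6.3 proof (p. 25)] -/
theorem hasDegreeLE_walsh_of_card_le {S : Finset (Fin m)} {k : ℕ} (h : S.card ≤ k) :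
    HasDegreeLE k (walsh S) := by
  obtain ⟨P, hP, hPx⟩ := hasDegreeLE_walsh S
  exact ⟨P, hP.trans h, hPx⟩

/-! ### `HasDegreeLE` versus vanishing of Fourier coefficients -/

/-- A monomial of the cube point `∏_{i ∈ A} x_i^{α_i}` only reads the coordinates in `A`: it is
unchanged by overriding the coordinates outside `A`. [cite: LeeRaghavendraSteurer2015, §2 ("deg(g) denotes the degree as a multilinear polynomial")] -/
theorem prod_cubePoint_pow_piecewise (α : Fin m →₀ ℕ) (σ x : Fin m → Bool) :
    (∏ i ∈ α.support, cubePoint ((univ.filter fun i => i ∉ α.support).piecewise σ x) i ^ α i) =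
      ∏ i ∈ α.support, cubePoint x i ^ α i := by
  classical
  refine prod_congr rfl fun i hi => ?_
  have : ((univ.filter fun i => i ∉ α.support).piecewise σ x) i = x i := by
    rw [Finset.piecewise_eq_of_notMem]
    simp only [Finset.mem_filter, Finset.mem_univ, true_and, not_not]
    exact hi
  simp only [cubePoint, this]

/-- The support of an exponent vector is at most its degree: `|supp α| ≤ Σ_i α_i`. [cite: LeeRaghavendraSteurer2015, §2] -/
theorem card_support_le_sum (α : Fin m →₀ ℕ) : α.support.card ≤ α.sum fun _ e => e := by
  rw [Finsupp.sum, Finset.card_eq_sum_ones]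
  exact sum_le_sum fun i hi => Nat.one_le_iff_ne_zero.2 (Finsupp.mem_support_iff.1 hi)

/-- **Degree `≤ k` ⇒ Fourier coefficients vanish above level `k`.** A polynomial of total degree `≤ k`
is a combination of monomials each reading `≤ k` coordinates, and a function not reading coordinate
`i ∈ S` has `ĝ(S) = 0`. [cite: LeeRaghavendraSteurer2015, §6.1 (p. 24: "ℑ can be expressed as a degree-k multilinear polynomial")] -/
theorem HasDegreeLE.cubeFourierCoeff_eq_zero {k : ℕ} {g : (Fin m → Bool) → ℝ} (hg : HasDegreeLE k g)
    {S : Finset (Fin m)} (hS : k < S.card) : cubeFourierCoeff g S = 0 := by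
  classical
  obtain ⟨P, hP, hPg⟩ := hg
  -- expand `g` in monomials
  have hexp : g = fun x => ∑ α ∈ P.support, P.coeff α * ∏ i ∈ α.support, cubePoint x i ^ α i := by
    funext x; rw [← hPg x, MvPolynomial.eval_eq]
  rw [hexp, cubeFourierCoeff_sum_mul]
  refine sum_eq_zero fun α hα => ?_
  -- the monomial reads only `supp α`, a set of size `≤ k < |S|`
  have hcard : α.support.card < S.card :=
    lt_of_le_of_lt ((card_support_le_sum α).trans ((MvPolynomial.le_totalDegree hα).trans hP)) hS
  obtain ⟨i, hiS, hiα⟩ := Finset.exists_mem_notMem_of_card_lt_card hcard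
  have h0 := cubeFourierCoeff_piecewise_eq_zero
    (fun y : Fin m → Bool => ∏ i ∈ α.support, cubePoint y i ^ α i)
    (univ.filter fun i => i ∉ α.support) (fun _ => false) (T := S)
    ⟨i, hiS, by simpa [Finsupp.mem_support_iff] using hiα⟩
  have hdep : (fun x : Fin m → Bool => ∏ i ∈ α.support, cubePoint x i ^ α i) =
      fun x => (fun y : Fin m → Bool => ∏ i ∈ α.support, cubePoint y i ^ α i)
        ((univ.filter fun i => i ∉ α.support).piecewise (fun _ => false) x) := by
    funext x; exact (prod_cubePoint_pow_piecewise α (fun _ => false) x).symm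
  rw [hdep, h0, mul_zero]

/-- **Fourier coefficients vanish above level `k` ⇒ degree `≤ k`:** `g = Σ_{|S| ≤ k} ĝ(S) χ_S` and
each `χ_S`, `|S| ≤ k`, has degree `≤ k`. [cite: LeeRaghavendraSteurer2015, Thm 6.4 proof (p. 26: "D(x) = Σ_{|α| ≤ d} E_x[D(x)χ_α(x)] χ_α(x)")] -/
theorem hasDegreeLE_of_cubeFourierCoeff_eq_zero {k : ℕ} {g : (Fin m → Bool) → ℝ}
    (h : ∀ S : Finset (Fin m), k < S.card → cubeFourierCoeff g S = 0) : HasDegreeLE k g := by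
  have hinv : g = fun x => ∑ S, cubeFourierCoeff g S * walsh S x :=
    funext fun x => (sum_cubeFourierCoeff_mul_walsh g x).symm
  have hmem : (fun x => ∑ S, cubeFourierCoeff g S * walsh S x) ∈ degreeLESubmodule m k := by
    have : (fun x => ∑ S : Finset (Fin m), cubeFourierCoeff g S * walsh S x) =
        ∑ S : Finset (Fin m), cubeFourierCoeff g S • (walsh S : (Fin m → Bool) → ℝ) := by
      funext x; simp [Finset.sum_apply]
    rw [this]
    refine Submodule.sum_mem _ fun S _ => ?_
    by_cases hS : S.card ≤ k
    · exact Submodule.smul_mem _ _ (hasDegreeLE_walsh_of_card_le hS)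
    · rw [h S (not_le.1 hS), zero_smul]; exact Submodule.zero_mem _
  rw [hinv]
  exact hmem

/-- **The dictionary:** `g` has degree `≤ k` (agrees on the cube with a polynomial of total degree
`≤ k`) iff its Fourier–Walsh coefficients vanish on all sets of size `> k`.
[cite: LeeRaghavendraSteurer2015, §2 ("deg(g) denotes the degree of g as a multilinear polynomial")] -/
theorem hasDegreeLE_iff_cubeFourierCoeff_eq_zero {k : ℕ} {g : (Fin m → Bool) → ℝ} :
    HasDegreeLE k g ↔ ∀ S : Finset (Fin m), k < S.card → cubeFourierCoeff g S = 0 :=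
  ⟨fun hg _ hS => hg.cubeFourierCoeff_eq_zero hS, hasDegreeLE_of_cubeFourierCoeff_eq_zero⟩

/-- The same dictionary against `fourierDegree` (`FourierDegree.lean`): `HasDegreeLE k g ↔
fourierDegree g ≤ k`. [cite: LeeRaghavendraSteurer2015, §2] -/
theorem hasDegreeLE_iff_fourierDegree_le {k : ℕ} {g : (Fin m → Bool) → ℝ} :
    HasDegreeLE k g ↔ fourierDegree g ≤ k := by
  rw [hasDegreeLE_iff_cubeFourierCoeff_eq_zero]
  constructor
  · intro h
    classical
    unfold Literature.Computability.Complexity.fourierDegree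
    refine Finset.sup_le fun S hS => ?_
    rw [Finset.mem_filter] at hS
    by_contra hk
    exact hS.2 (h S (not_le.1 hk))
  · intro h S hS
    exact cubeFourierCoeff_eq_zero_of_lt (lt_of_le_of_lt h hS)

/-- Products: degrees add (`deg(gh) ≤ deg g + deg h`). [cite: LeeRaghavendraSteurer2015, §6.1 (p. 24: "inner products with functions of degree at most d")] -/
theorem HasDegreeLE.mul {j k : ℕ} {g h : (Fin m → Bool) → ℝ} (hg : HasDegreeLE j g)
    (hh : HasDegreeLE k h) : HasDegreeLE (j + k) (fun x => g x * h x) := by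
  obtain ⟨P, hP, hPg⟩ := hg
  obtain ⟨Q, hQ, hQh⟩ := hh
  exact ⟨P * Q, (MvPolynomial.totalDegree_mul P Q).trans (add_le_add hP hQ), fun x => by
    simp [hPg x, hQh x]⟩

/-- Squares of degree-`≤ d/2` functions have degree `≤ 2⌊d/2⌋ ≤ d`. [cite: LeeRaghavendraSteurer2015, §6.1 (p. 24)] -/
theorem HasDegreeLE.sq_half {d : ℕ} {g : (Fin m → Bool) → ℝ} (hg : HasDegreeLE (d / 2) g) :
    HasDegreeLE (2 * (d / 2)) (fun x => g x ^ 2) := by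
  have := hg.mul hg
  simp only [sq]
  convert this using 1
  ring

/-! ### Characters: algebra -/

/-- `χ_S(x)² = 1`. [cite: LeeRaghavendraSteurer2015, Fact 6.3 proof (p. 25)] -/
theorem walsh_mul_self (S : Finset (Fin m)) (x : Fin m → Bool) : walsh S x * walsh S x = 1 := by
  unfold Literature.Probability.RandomGraphs.LowDegree.walsh
  rw [← prod_mul_distrib]
  exact prod_eq_one fun i _ => Literature.Probability.RandomGraphs.LowDegree.sgn_mul_self _

/-- `|χ_S(x)| = 1`. [cite: LeeRaghavendraSteurer2015, Thm 6.4 proof (p. 26)] -/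
theorem abs_walsh (S : Finset (Fin m)) (x : Fin m → Bool) : |walsh S x| = 1 := by
  have h := walsh_mul_self S x
  have : |walsh S x| * |walsh S x| = 1 := by rw [← abs_mul, h, abs_one]
  nlinarith [abs_nonneg (walsh S x)]

/-- `χ_A χ_B = χ_{A ∪ B}` for disjoint `A, B`. [cite: LeeRaghavendraSteurer2015, Fact 6.3 proof (p. 25: "χ_α = χ_A χ_B")] -/
theorem walsh_mul_walsh_of_disjoint {A B : Finset (Fin m)} (h : Disjoint A B) (x : Fin m → Bool) :
    walsh A x * walsh B x = walsh (A ∪ B) x := by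
  unfold Literature.Probability.RandomGraphs.LowDegree.walsh
  rw [prod_union h]

/-! ### Fact 6.3 -/

/-- **Lee–Raghavendra–Steurer 2015, Fact 6.3 (PROVED).** "For every positive even integer `d`, every
degree-`d` pseudo-density `D : {0,1}^m → ℝ` and every subset `α ⊆ [m]`, `|α| ≤ d`, we have
`|E_x D(x) χ_α(x)| ≤ 1`."  Printed proof: write `χ_α = χ_A χ_B` with `|A|, |B| ≤ d/2`; then
`E D χ_α = E D (1 − (χ_A − χ_B)²/2) ≤ E D = 1` and `χ_α = (χ_A + χ_B)²/2 − 1` gives the other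
inequality.  Stated for every `d` under `|α| ≤ 2⌊d/2⌋` (`= d` for the printed even `d`).
[cite: LeeRaghavendraSteurer2015, Fact 6.3 (p. 25)] -/
theorem IsPseudoDensity.abs_cubeFourierCoeff_le_one {d : ℕ} {D : (Fin m → Bool) → ℝ}
    (hD : IsPseudoDensity d D) {α : Finset (Fin m)} (hα : α.card ≤ 2 * (d / 2)) :
    |cubeFourierCoeff D α| ≤ 1 := by
  classical
  -- split `α = A ∪ B`, `|A|, |B| ≤ d/2`
  obtain ⟨A, hAα, hA⟩ := Finset.exists_subset_card_eq (s := α) (n := min α.card (d / 2))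
    (min_le_left _ _)
  set B := α \ A with hB
  have hAB : Disjoint A B := by rw [hB]; exact Finset.disjoint_sdiff
  have hunion : A ∪ B = α := by rw [hB]; exact Finset.union_sdiff_of_subset hAα
  have hAcard : A.card ≤ d / 2 := hA ▸ min_le_right _ _
  have hBcard : B.card ≤ d / 2 := by
    have := Finset.card_sdiff_add_card_eq_card hAα
    rw [← hB] at this
    omega
  have hdegA : HasDegreeLE (d / 2) (walsh A) := hasDegreeLE_walsh_of_card_le hAcard
  have hdegB : HasDegreeLE (d / 2) (walsh B) := hasDegreeLE_walsh_of_card_le hBcard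
  -- `χ_A ± χ_B` have degree `≤ d/2`
  have hsub : HasDegreeLE (d / 2) (fun x => walsh A x - walsh B x) :=
    (degreeLESubmodule m (d / 2)).sub_mem hdegA hdegB
  have hadd : HasDegreeLE (d / 2) (fun x => walsh A x + walsh B x) :=
    (degreeLESubmodule m (d / 2)).add_mem hdegA hdegB
  -- `(χ_A ∓ χ_B)² = 2 ∓ 2 χ_α`
  have hsq_sub : ∀ x, D x * (walsh A x - walsh B x) ^ 2 = 2 * D x - 2 * (D x * walsh α x) := by
    intro x
    rw [← hunion, ← walsh_mul_walsh_of_disjoint hAB]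
    linear_combination (D x) * walsh_mul_self A x + (D x) * walsh_mul_self B x
  have hsq_add : ∀ x, D x * (walsh A x + walsh B x) ^ 2 = 2 * D x + 2 * (D x * walsh α x) := by
    intro x
    rw [← hunion, ← walsh_mul_walsh_of_disjoint hAB]
    linear_combination (D x) * walsh_mul_self A x + (D x) * walsh_mul_self B x
  have h1 := hD.2 _ hsub
  have h2 := hD.2 _ hadd
  simp_rw [hsq_sub] at h1
  simp_rw [hsq_add] at h2
  have hlin : ∀ (s : ℝ), cubeExpect (fun x => 2 * D x + s * (D x * walsh α x)) =
      2 * cubeExpect D + s * cubeFourierCoeff D α := by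
    intro s
    rw [← cubeExpect_mul_walsh]
    simp only [cubeExpect, Finset.sum_add_distrib, ← Finset.mul_sum, add_div, mul_div_assoc]
  have h1' : 0 ≤ 2 * cubeExpect D + (-2) * cubeFourierCoeff D α := by
    rw [← hlin]; simpa [sub_eq_add_neg] using h1
  have h2' : 0 ≤ 2 * cubeExpect D + 2 * cubeFourierCoeff D α := by rw [← hlin]; exact h2
  rw [hD.1] at h1' h2'
  rw [abs_le]
  constructor <;> linarith

/-! ### Truncation to low Fourier levels -/

/-- The **truncation** `D_{≤ℓ} = Σ_{|S| ≤ ℓ} D̂(S) χ_S` of `D` to Fourier levels `≤ ℓ`.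
[cite: LeeRaghavendraSteurer2015, §6.1 (p. 24: "without loss of generality, we may assume deg(D) ≤ d")] -/
def fourierTruncate (ℓ : ℕ) (D : (Fin m → Bool) → ℝ) : (Fin m → Bool) → ℝ :=
  fun x => ∑ S ∈ univ.filter (fun S : Finset (Fin m) => S.card ≤ ℓ), cubeFourierCoeff D S * walsh S x

/-- Coefficients of a Walsh combination (orthogonality): `(Σ_{S∈F} a_S χ_S)^(T) = [T ∈ F] a_T`.
[cite: LeeRaghavendraSteurer2015, Thm 6.4 proof (p. 26)] -/
theorem cubeFourierCoeff_sum_walsh (F : Finset (Finset (Fin m))) (a : Finset (Fin m) → ℝ)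
    (T : Finset (Fin m)) :
    cubeFourierCoeff (fun x => ∑ S ∈ F, a S * walsh S x) T = if T ∈ F then a T else 0 := by
  classical
  rw [cubeFourierCoeff_sum_mul]
  have hco : ∀ S, cubeFourierCoeff (walsh S : (Fin m → Bool) → ℝ) T = if S = T then 1 else 0 := by
    intro S
    unfold Literature.Computability.Complexity.LowDegree.cubeFourierCoeff
    rw [sum_walsh_mul_walsh_index]
    split_ifs
    · exact div_self (pow_ne_zero _ two_ne_zero)
    · simp
  simp_rw [hco, mul_ite, mul_one, mul_zero]
  rw [Finset.sum_ite_eq']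

/-- Coefficients of the truncation: `D̂_{≤ℓ}(T) = D̂(T)` for `|T| ≤ ℓ`, else `0`.
[cite: LeeRaghavendraSteurer2015, Thm 6.4 proof (p. 26)] -/
theorem cubeFourierCoeff_fourierTruncate (ℓ : ℕ) (D : (Fin m → Bool) → ℝ) (T : Finset (Fin m)) :
    cubeFourierCoeff (fourierTruncate ℓ D) T = if T.card ≤ ℓ then cubeFourierCoeff D T else 0 := by
  unfold fourierTruncate
  rw [cubeFourierCoeff_sum_walsh]
  simp

/-- The truncation has degree `≤ ℓ`. [cite: LeeRaghavendraSteurer2015, §6.1 (p. 24)] -/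
theorem hasDegreeLE_fourierTruncate (ℓ : ℕ) (D : (Fin m → Bool) → ℝ) :
    HasDegreeLE ℓ (fourierTruncate ℓ D) :=
  hasDegreeLE_of_cubeFourierCoeff_eq_zero fun S hS => by
    rw [cubeFourierCoeff_fourierTruncate, if_neg (not_le.2 hS)]

/-- **Plancherel on the cube:** `E_x D(x) h(x) = Σ_S D̂(S) ĥ(S)`. [cite: LeeRaghavendraSteurer2015, §6.1 (p. 24: "⟨D, h⟩")] -/
theorem cubeExpect_mul_eq_sum_cubeFourierCoeff (D h : (Fin m → Bool) → ℝ) :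
    cubeExpect (fun x => D x * h x) = ∑ S, cubeFourierCoeff D S * cubeFourierCoeff h S := by
  have hinv : (fun x => D x * h x) = fun x => ∑ S, cubeFourierCoeff h S * (D x * walsh S x) := by
    funext x
    rw [← sum_cubeFourierCoeff_mul_walsh h x, Finset.mul_sum]
    exact sum_congr rfl fun S _ => by ring
  rw [hinv]
  have := cubeFourierCoeff_sum_mul (univ : Finset (Finset (Fin m))) (fun S => cubeFourierCoeff h S)
    (fun S x => D x * walsh S x) ∅
  -- `cubeExpect f = f̂(∅)` up to the character `χ_∅ = 1`
  have hE : ∀ f : (Fin m → Bool) → ℝ, cubeExpect f = cubeFourierCoeff f ∅ := by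
    intro f
    unfold cubeExpect Literature.Computability.Complexity.LowDegree.cubeFourierCoeff
    simp
  rw [hE, this]
  refine sum_congr rfl fun S _ => ?_
  rw [← hE, cubeExpect_mul_walsh, mul_comm]

/-- **The truncation pairs like `D` with low-degree functions:** for `h` of degree `≤ ℓ`,
`E D_{≤ℓ} h = E D h`. [cite: LeeRaghavendraSteurer2015, §6.1 (p. 24: "without loss of generality, we may assume deg(D) ≤ d")] -/
theorem cubeExpect_fourierTruncate_mul {ℓ : ℕ} (D : (Fin m → Bool) → ℝ) {h : (Fin m → Bool) → ℝ}
    (hh : HasDegreeLE ℓ h) :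
    cubeExpect (fun x => fourierTruncate ℓ D x * h x) = cubeExpect (fun x => D x * h x) := by
  rw [cubeExpect_mul_eq_sum_cubeFourierCoeff, cubeExpect_mul_eq_sum_cubeFourierCoeff]
  refine sum_congr rfl fun S _ => ?_
  rw [cubeFourierCoeff_fourierTruncate]
  split_ifs with hS
  · rfl
  · rw [hh.cubeFourierCoeff_eq_zero (not_le.1 hS), mul_zero, mul_zero]

/-- **The truncation of a pseudo-density is a pseudo-density** (of the same degree `d`), as soon as
the truncation level `ℓ` is at least `2⌊d/2⌋` (the degree of the squares `g²`, `deg g ≤ d/2`, and of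
the constant `1`). [cite: LeeRaghavendraSteurer2015, §6.1 (p. 24)] -/
theorem isPseudoDensity_fourierTruncate {d ℓ : ℕ} {D : (Fin m → Bool) → ℝ} (hD : IsPseudoDensity d D)
    (hℓ : 2 * (d / 2) ≤ ℓ) : IsPseudoDensity d (fourierTruncate ℓ D) := by
  refine ⟨?_, fun g hg => ?_⟩
  · have h1 : HasDegreeLE ℓ (fun _ : Fin m → Bool => (1 : ℝ)) := HasDegreeLE.const ℓ 1
    have := cubeExpect_fourierTruncate_mul D h1
    simp only [mul_one] at this
    rw [this]
    exact hD.1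
  · have hg2 : HasDegreeLE ℓ (fun x => g x ^ 2) := by
      obtain ⟨P, hP, hPx⟩ := hg.sq_half
      exact ⟨P, hP.trans hℓ, hPx⟩
    rw [cubeExpect_fourierTruncate_mul D hg2]
    exact hD.2 g hg

/-- **Sup-norm bound for a truncated pseudo-density:** if `ℓ ≤ 2⌊d/2⌋` then
`|D_{≤ℓ}(x)| ≤ #{S ⊆ [m] : |S| ≤ ℓ}` (`= Σ_{i ≤ ℓ} C(m,i)`), by Fact 6.3 and `|χ_S| = 1`.
[cite: LeeRaghavendraSteurer2015, Thm 6.4 proof (p. 26: "‖D‖_∞ ≤ Σ_{i=0}^{d(n)} C(n,i)")] -/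
theorem IsPseudoDensity.abs_fourierTruncate_le {d ℓ : ℕ} {D : (Fin m → Bool) → ℝ}
    (hD : IsPseudoDensity d D) (hℓ : ℓ ≤ 2 * (d / 2)) (x : Fin m → Bool) :
    |fourierTruncate ℓ D x| ≤ ((univ.filter fun S : Finset (Fin m) => S.card ≤ ℓ).card : ℝ) := by
  unfold fourierTruncate
  refine (Finset.abs_sum_le_sum_abs _ _).trans ?_
  rw [Finset.card_eq_sum_ones, Nat.cast_sum]
  refine sum_le_sum fun S hS => ?_
  rw [Finset.mem_filter] at hS
  rw [abs_mul, abs_walsh, mul_one, Nat.cast_one]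
  exact hD.abs_cubeFourierCoeff_le_one (hS.2.trans hℓ)

/-- `#{S ⊆ [m] : |S| ≤ ℓ} = Σ_{i ≤ ℓ} C(m, i)`. [cite: LeeRaghavendraSteurer2015, Thm 6.4 proof (p. 26)] -/
theorem card_filter_card_le (m ℓ : ℕ) :
    (univ.filter fun S : Finset (Fin m) => S.card ≤ ℓ).card = ∑ i ∈ range (ℓ + 1), m.choose i := by
  classical
  have : (univ.filter fun S : Finset (Fin m) => S.card ≤ ℓ) =
      (range (ℓ + 1)).biUnion fun i => powersetCard i (univ : Finset (Fin m)) := by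
    ext S
    simp [Finset.mem_powersetCard]
  rw [this, Finset.card_biUnion]
  · refine sum_congr rfl fun i _ => ?_
    rw [Finset.card_powersetCard, Finset.card_univ, Fintype.card_fin]
  · intro i _ j _ hij
    exact Finset.disjoint_left.2 fun S h1 h2 =>
      hij ((Finset.mem_powersetCard.1 h1).2.symm.trans (Finset.mem_powersetCard.1 h2).2)

/-- **The "WLOG `deg D ≤ d`" step of the proof of Thm 6.4, assembled:** a degree-`d` pseudo-density
`D` with `E_x D(x) f(x) < −ε` for some `f` of degree `≤ 2⌊d/2⌋` may be replaced by one of degree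
`≤ 2⌊d/2⌋` with the same property and `‖·‖_∞ ≤ Σ_{i ≤ 2⌊d/2⌋} C(m, i)`.
[cite: LeeRaghavendraSteurer2015, Thm 6.4 proof (p. 26)] -/
theorem IsPseudoDensity.exists_lowDegree {d : ℕ} {D f : (Fin m → Bool) → ℝ} (hD : IsPseudoDensity d D)
    (hf : HasDegreeLE (2 * (d / 2)) f) {ε : ℝ} (hε : cubeExpect (fun x => D x * f x) < -ε) :
    ∃ D' : (Fin m → Bool) → ℝ, IsPseudoDensity d D' ∧ HasDegreeLE (2 * (d / 2)) D' ∧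
      cubeExpect (fun x => D' x * f x) < -ε ∧
      ∀ x, |D' x| ≤ ((∑ i ∈ range (2 * (d / 2) + 1), m.choose i : ℕ) : ℝ) := by
  refine ⟨fourierTruncate (2 * (d / 2)) D, isPseudoDensity_fourierTruncate hD le_rfl,
    hasDegreeLE_fourierTruncate _ _, ?_, fun x => ?_⟩
  · rwa [cubeExpect_fourierTruncate_mul D hf]
  · rw [← card_filter_card_le]
    exact hD.abs_fourierTruncate_le le_rfl x

/-! ### The binomial bound `Σ_{i ≤ ℓ} C(n,i) ≤ 1 + n^ℓ` and the proof of Theorem 6.4 up to Theorem 3.8 (append) -/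

/-- The induction step of the binomial bound: `n^{j+1} + C(n, j+2) ≤ n^{j+2}` (for `n = m + 1`:
`(j+2)·C(m+1,j+2) = (m+1)·C(m,j+1) ≤ (m+1) m^{j+1} ≤ (m+1)^{j+1} m · (j+2)`).
[cite: LeeRaghavendraSteurer2015, Thm 6.4 proof (p. 26: "Σ_{i=0}^{d(n)} C(n,i) ≤ 1 + n^{d(n)}")] -/
theorem pow_add_choose_le_pow (n j : ℕ) : n ^ (j + 1) + n.choose (j + 2) ≤ n ^ (j + 2) := by
  rcases n with _ | m
  · simp
  · -- `(m+1) * C(m, j+1) = C(m+1, j+2) * (j+2)`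
    have h : (m + 1) * m.choose (j + 1) = (m + 1).choose (j + 2) * (j + 2) :=
      Nat.add_one_mul_choose_eq m (j + 1)
    have hc : (m + 1).choose (j + 2) ≤ (m + 1) * m.choose (j + 1) := by
      have : (m + 1).choose (j + 2) * 1 ≤ (m + 1).choose (j + 2) * (j + 2) :=
        Nat.mul_le_mul_left _ (by omega)
      rw [mul_one] at this
      calc (m + 1).choose (j + 2) ≤ (m + 1).choose (j + 2) * (j + 2) := this
        _ = (m + 1) * m.choose (j + 1) := h.symm
    have hp : (m + 1) * m.choose (j + 1) ≤ (m + 1) ^ (j + 1) * m := by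
      calc (m + 1) * m.choose (j + 1) ≤ (m + 1) * m ^ (j + 1) :=
            Nat.mul_le_mul_left _ (Nat.choose_le_pow m (j + 1))
        _ = (m + 1) * m ^ j * m := by rw [pow_succ]; ring
        _ ≤ (m + 1) * (m + 1) ^ j * m :=
            Nat.mul_le_mul_right _ (Nat.mul_le_mul_left _ (Nat.pow_le_pow_left (Nat.le_succ m) j))
        _ = (m + 1) ^ (j + 1) * m := by ring
    calc (m + 1) ^ (j + 1) + (m + 1).choose (j + 2)
        ≤ (m + 1) ^ (j + 1) + (m + 1) ^ (j + 1) * m := Nat.add_le_add_left (hc.trans hp) _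
      _ = (m + 1) ^ (j + 2) := by ring

/-- **`Σ_{i=0}^{ℓ} C(n,i) ≤ 1 + n^ℓ`** (for every `n` and `ℓ`; the bound of the proof of Thm 6.4,
"`‖D‖_∞ ≤ Σ_{i=0}^{d(n)} C(n,i) ≤ 1 + n^{d(n)}`"). [cite: LeeRaghavendraSteurer2015, Thm 6.4 proof (p. 26)] -/
theorem sum_range_choose_le_one_add_pow (n ℓ : ℕ) :
    ∑ i ∈ range (ℓ + 1), n.choose i ≤ 1 + n ^ ℓ := by
  induction ℓ with
  | zero => simp
  | succ j ih =>
    rcases j with _ | j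
    · simp [Finset.sum_range_succ]
    · rw [Finset.sum_range_succ]
      calc ∑ i ∈ range (j + 1 + 1), n.choose i + n.choose (j + 1 + 1)
          ≤ 1 + n ^ (j + 1) + n.choose (j + 2) := Nat.add_le_add_right ih _
        _ = 1 + (n ^ (j + 1) + n.choose (j + 2)) := by ring
        _ ≤ 1 + n ^ (j + 2) := Nat.add_le_add_left (pow_add_choose_le_pow n j) _

/-- **A size-`0` psd factorisation of `M^{N,Π}_{c,s}` is impossible as soon as some instance on `N`
variables has `opt ≤ s < c`** (its row is `c − ℑ(x) > 0`, while `Tr` of a product of `0 × 0`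
matrices is `0`) — the trivial range of the bound of Thm 6.4. [cite: LeeRaghavendraSteurer2015, Prop. 6.1 (p. 25)] -/
theorem not_hasPsdFactorization_cspMatrix_zero {k N : ℕ} {P : Set ((Fin k → Bool) → Bool)}
    {c s : ℝ} (I : CSPInstance k N P) (hI : I.OptLE s) (hsc : s < c) :
    ¬ HasPsdFactorization (cspMatrix k N P c s) 0 := by
  rintro ⟨A, B, -, -, hM⟩
  have h := hM ⟨I, hI⟩ (fun _ => false)
  simp only [cspMatrix, Matrix.trace, Finset.univ_eq_empty, Finset.sum_empty] at h
  have := hI (fun _ => false)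
  linarith

/-- Sound instances plant to more variables: if Max-`𝒫_n` has an instance with `opt ≤ s` then so does
Max-`𝒫_N` for every `N ≥ n`. [cite: LeeRaghavendraSteurer2015, §6.2 (p. 25–26)] -/
theorem exists_optLE_of_le {k n N : ℕ} {P : Set ((Fin k → Bool) → Bool)} {s : ℝ}
    (I : CSPInstance k n P) (hI : I.OptLE s) (h : n ≤ N) :
    ∃ J : CSPInstance k N P, J.OptLE s :=
  ⟨I.plant (Fin.castLEEmb h), hI.plant _⟩

/-- **The proof of Lee–Raghavendra–Steurer's Theorem 6.4 up to Theorem 3.8 (PROVED):** if the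
degree-`d` sos relaxation (`d ≥ 2⌈k/2⌉`) fails to achieve a `(c + ε, s)`-approximation for Max-`𝒫_n`,
then there are an instance `ℑ` on `n` variables with `opt(ℑ) ≤ s` and a degree-`d` pseudo-density
`D` OF DEGREE `≤ 2⌊d/2⌋ ≤ d` with `E_x D(x)(c − ℑ(x)) < −ε` and `‖D‖_∞ ≤ 1 + n^{2⌊d/2⌋} ≤ 1 + n^d`
— the §2 duality (`exists_pseudoDensity_of_not_achievesApprox`), the truncation "WLOG `deg D ≤ d`"
(`IsPseudoDensity.exists_lowDegree`, using `deg ℑ ≤ k ≤ 2⌊d/2⌋`), Fact 6.3 and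
`Σ_{i ≤ d} C(n,i) ≤ 1 + n^d`.  What then remains of the printed proof is Theorem 3.8
(`LeeRaghavendraSteurer2015_thm38.cspMatrix_bound`) and arithmetic.
[cite: LeeRaghavendraSteurer2015, Thm 6.4 proof (p. 26)] -/
theorem LeeRaghavendraSteurer2015_thm64_reduction {k n d : ℕ} {P : Set ((Fin k → Bool) → Bool)}
    {c ε s : ℝ} (hkd : 2 * ((k + 1) / 2) ≤ d)
    (h : ¬ AchievesApprox P (degreeLE n (d / 2)) (c + ε) s) :
    ∃ I : CSPInstance k n P, I.OptLE s ∧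
      ∃ D : (Fin n → Bool) → ℝ, IsPseudoDensity d D ∧ HasDegreeLE (2 * (d / 2)) D ∧
        cubeExpect (fun x => D x * (c - I.val x)) < -ε ∧
        ∀ x, |D x| ≤ 1 + (n : ℝ) ^ (2 * (d / 2)) := by
  obtain ⟨I, hI, D₀, hD₀, hneg⟩ := exists_pseudoDensity_of_not_achievesApprox h
  -- `c − ℑ` has degree `≤ k ≤ 2⌊d/2⌋`
  have hk : k ≤ 2 * (d / 2) := by omega
  have hf : HasDegreeLE (2 * (d / 2)) (fun x => c - I.val x) := by
    have hval : HasDegreeLE (2 * (d / 2)) I.val := by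
      obtain ⟨Q, hQ, hQx⟩ := I.hasDegreeLE_val
      exact ⟨Q, hQ.trans hk, hQx⟩
    exact (degreeLESubmodule n (2 * (d / 2))).sub_mem (HasDegreeLE.const _ c) hval
  obtain ⟨D, hD, hdeg, hDneg, hbound⟩ := hD₀.exists_lowDegree hf hneg
  refine ⟨I, hI, D, hD, hdeg, hDneg, fun x => (hbound x).trans ?_⟩
  exact_mod_cast sum_range_choose_le_one_add_pow n (2 * (d / 2))

/-! ### The closing arithmetic of the proof of Theorem 6.4 -/

/-- `t ↦ t − log t` is monotone on `[1, ∞)`. [folklore] -/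
private theorem sub_log_le_sub_log {a b : ℝ} (ha : 1 ≤ a) (hab : a ≤ b) :
    a - Real.log a ≤ b - Real.log b := by
  have ha0 : 0 < a := by linarith
  have hb0 : 0 < b := by linarith
  have h : Real.log b - Real.log a = Real.log (b / a) := by
    rw [Real.log_div hb0.ne' ha0.ne']
  have h2 : Real.log (b / a) ≤ b / a - 1 := Real.log_le_sub_one_of_pos (div_pos hb0 ha0)
  have h3 : b / a - 1 ≤ b - a := by
    rw [div_sub_one ha0.ne', div_le_iff₀ ha0]
    nlinarith
  linarith

/-- **The quantitative core of the proof of Thm 6.4:** with `‖D‖_∞ ≤ B ≤ 2n^d`, `E(c − ℑ) ≥ c − s`,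
`N ≥ n^{4d}`, `24 ≤ d ≤ n` and `n` beyond an explicit threshold depending only on the constants, the
bound of Thm 3.8 exceeds `2 n^{d²/8}`. [cite: LeeRaghavendraSteurer2015, Thm 6.4 proof (p. 26: "whenever N > n^{4d(n)}, we have rk_psd(M_N^f) ≥ n^{d(n)²/8}")] -/
theorem thm38_bound_ge {c₀ ε cs E B N n d : ℝ} (hc₀ : 0 < c₀) (hε : 0 < ε) (hcs : 0 < cs)
    (hE : cs ≤ E) (hn : 2 ≤ n) (hd : 24 ≤ d) (hdn : d ≤ n) (hB1 : 1 ≤ B) (hB : B ≤ 2 * n ^ d)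
    (hN : n ^ (4 * d) ≤ N)
    (hlog : |Real.log (c₀ * ε / 8)| +
        |3 / 2 * Real.log ε - 3 / 2 * Real.log 2 + 1 / 2 * Real.log cs| + 1 ≤ Real.log n) :
    2 * n ^ (d ^ 2 / 8) ≤
      (c₀ * ε * N / (d * n ^ (2 : ℕ) * B * Real.log N)) ^ (d / 4) * (ε / B) ^ ((3 : ℝ) / 2) *
        Real.sqrt E := by
  -- positivity bookkeeping
  have hn0 : 0 < n := by linarith
  have hn1 : 1 < n := by linarith
  have hL : 0 < Real.log n := Real.log_pos hn1
  set L := Real.log n with hLdef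
  have hd0 : 0 < d := by linarith
  have hd1 : 1 ≤ d := by linarith
  have hB0 : 0 < B := by linarith
  have hE0 : 0 < E := lt_of_lt_of_le hcs hE
  have hnd : 0 < n ^ d := Real.rpow_pos_of_pos hn0 d
  have hn4d : 0 < n ^ (4 * d) := Real.rpow_pos_of_pos hn0 _
  have hN0 : 0 < N := lt_of_lt_of_le hn4d hN
  -- `log N ≥ 4 d L ≥ 96 L > 1`
  have hlogN : 4 * d * L ≤ Real.log N := by
    have := Real.log_le_log hn4d hN
    rwa [Real.log_rpow hn0] at this
  have hL2 : Real.log 2 ≤ L := Real.log_le_log two_pos hn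
  have hlog2 : (1 : ℝ) / 2 < Real.log 2 := by
    have := Real.log_two_gt_d9; linarith
  have hlog2' : Real.log 2 < 1 := by
    have := Real.log_two_lt_d9; linarith
  have hdL : 24 * Real.log 2 ≤ d * L :=
    mul_le_mul hd hL2 (Real.log_nonneg one_le_two) hd0.le
  have h4dL : 1 ≤ 4 * d * L := by linarith
  have hlogN1 : 1 ≤ Real.log N := h4dL.trans hlogN
  have hlogN0 : 0 < Real.log N := by linarith
  -- the base of the first factor
  set base := c₀ * ε * N / (d * n ^ (2 : ℕ) * B * Real.log N) with hbase
  have hden : 0 < d * n ^ (2 : ℕ) * B * Real.log N := by positivity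
  have hbase0 : 0 < base := by rw [hbase]; positivity
  -- logarithms of the pieces
  have hlog_base : Real.log base = Real.log (c₀ * ε) + Real.log N - Real.log d - 2 * L - Real.log B -
      Real.log (Real.log N) := by
    rw [hbase, Real.log_div (by positivity) hden.ne', Real.log_mul (by positivity) hN0.ne',
      Real.log_mul (by positivity) hlogN0.ne', Real.log_mul (by positivity) hB0.ne',
      Real.log_mul hd0.ne' (by positivity), Real.log_pow]
    push_cast
    ring
  -- `log N − log log N ≥ 4dL − log(4dL)`
  have hT1 : 4 * d * L - Real.log (4 * d * L) ≤ Real.log N - Real.log (Real.log N) :=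
    sub_log_le_sub_log h4dL hlogN
  -- `log (4 d L) ≤ log 4 + L + L`
  have hlogd : Real.log d ≤ L := Real.log_le_log hd0 hdn
  have hlogd0 : 0 ≤ Real.log d := Real.log_nonneg hd1
  have hlogL : Real.log L ≤ L := (Real.log_le_sub_one_of_pos hL).trans (by linarith)
  have hT2 : Real.log (4 * d * L) ≤ Real.log 4 + L + L := by
    rw [Real.log_mul (by positivity) hL.ne', Real.log_mul (by norm_num) hd0.ne']
    linarith
  have hlog4 : Real.log 4 = 2 * Real.log 2 := by
    rw [show (4 : ℝ) = 2 ^ 2 by norm_num, Real.log_pow]; push_cast; ring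
  -- `log B ≤ log 2 + d L`
  have hlogB : Real.log B ≤ Real.log 2 + d * L := by
    have := Real.log_le_log hB0 hB
    rwa [Real.log_mul two_ne_zero hnd.ne', Real.log_rpow hn0] at this
  have hlogB0 : 0 ≤ Real.log B := Real.log_nonneg hB1
  -- `log base ≥ log(c₀ε/8) + (3d − 5) L`
  have hC₁ : Real.log (c₀ * ε / 8) = Real.log (c₀ * ε) - 3 * Real.log 2 := by
    rw [Real.log_div (by positivity) (by norm_num), show (8 : ℝ) = 2 ^ 3 by norm_num, Real.log_pow]
    push_cast; ring
  have hbase_ge : Real.log (c₀ * ε / 8) + (3 * d - 5) * L ≤ Real.log base := by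
    rw [hlog_base, hC₁]
    linarith [hT1, hT2, hlogB, hlogd, hlog4]
  -- `log Φ`
  set Φ := base ^ (d / 4) * (ε / B) ^ ((3 : ℝ) / 2) * Real.sqrt E with hΦ
  have hΦ0 : 0 < Φ := by rw [hΦ]; positivity
  have hlogΦ : Real.log Φ = d / 4 * Real.log base + 3 / 2 * (Real.log ε - Real.log B) +
      1 / 2 * Real.log E := by
    rw [hΦ, Real.log_mul (by positivity) (Real.sqrt_pos.2 hE0).ne',
      Real.log_mul (by positivity) (by positivity), Real.log_rpow hbase0,
      Real.log_rpow (by positivity), Real.log_div hε.ne' hB0.ne', Real.log_sqrt hE0.le]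
    ring
  have hlogE : Real.log cs ≤ Real.log E := Real.log_le_log hcs hE
  -- the target in logarithms
  have htarget : Real.log 2 + d ^ 2 / 8 * L ≤ Real.log Φ := by
    rw [hlogΦ]
    have hd4 : 0 ≤ d / 4 := by positivity
    have h1 : d / 4 * (Real.log (c₀ * ε / 8) + (3 * d - 5) * L) ≤ d / 4 * Real.log base :=
      mul_le_mul_of_nonneg_left hbase_ge hd4
    -- abbreviations for the constants
    set C₁ := Real.log (c₀ * ε / 8) with hC₁def
    set C₂ := 3 / 2 * Real.log ε - 3 / 2 * Real.log 2 + 1 / 2 * Real.log cs with hC₂def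
    have hC₁abs : -|C₁| ≤ C₁ := neg_abs_le C₁
    have hC₂abs : -|C₂| ≤ C₂ := neg_abs_le C₂
    have hkey : d / 4 * |C₁| + |C₂| + Real.log 2 ≤ 12 * d * L := by
      have p1 : 12 * d * (|C₁| + |C₂| + 1) ≤ 12 * d * L :=
        mul_le_mul_of_nonneg_left hlog (by positivity)
      have p2 : 0 ≤ d * |C₁| := by positivity
      have p3 : 0 ≤ d * |C₂| := by positivity
      have p4 : 0 ≤ |C₂| := abs_nonneg C₂
      have p5 : |C₂| ≤ d * |C₂| := le_mul_of_one_le_left p4 hd1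
      linarith
    have hslack : 12 * d * L ≤ (5 * d ^ 2 - 22 * d) / 8 * L := by
      have h5 : (0 : ℝ) ≤ 5 * d - 118 := by linarith
      have hprod : 0 ≤ d * (5 * d - 118) / 8 * L := by positivity
      have hring : (5 * d ^ 2 - 22 * d) / 8 * L - 12 * d * L = d * (5 * d - 118) / 8 * L := by ring
      linarith
    have hdC : -(d / 4 * |C₁|) ≤ d / 4 * C₁ := by
      have := mul_le_mul_of_nonneg_left hC₁abs hd4
      linarith
    linarith [h1, hlogB, hlogE, hC₂abs, hkey, hslack, hdC]
  -- exponentiate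
  have : 2 * n ^ (d ^ 2 / 8) = Real.exp (Real.log 2 + d ^ 2 / 8 * L) := by
    rw [Real.exp_add, Real.exp_log two_pos, hLdef, Real.rpow_def_of_pos hn0]
    ring_nf
  rw [this, ← Real.exp_log hΦ0]
  exact Real.exp_le_exp.2 htarget

/-- **Lee–Raghavendra–Steurer 2015, Theorem 6.4 (corrected statement) DERIVED from Theorem 3.8** —
the printed proof (p. 26) formalised end to end modulo the typed engine
`LeeRaghavendraSteurer2015_thm38`: §2 duality (`exists_pseudoDensity_of_not_achievesApprox`),
"WLOG `deg D ≤ d`" with Fact 6.3 and `‖D‖_∞ ≤ Σ_{i≤d} C(n,i) ≤ 1 + n^d`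
(`LeeRaghavendraSteurer2015_thm64_reduction`), Theorem 3.8 on the submatrix `M_N^f` of
`M^{N,Π}_{c,s}` (`LeeRaghavendraSteurer2015_thm38.cspMatrix_bound`), and the closing arithmetic
(`thm38_bound_ge`: for `d(n) ≥ 24` and `n` beyond a threshold the bound exceeds `2 n^{d(n)²/8}`;
smaller `n` are absorbed into the constant `K`, where the bound only has to exclude `r = 0`,
`not_hasPsdFactorization_cspMatrix_zero`).
[cite: LeeRaghavendraSteurer2015, Thm 6.4 and its proof (p. 25–26)] -/
theorem LeeRaghavendraSteurer2015_thm64_repaired_of_thm38 (h38 : LeeRaghavendraSteurer2015_thm38) :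
    LeeRaghavendraSteurer2015_thm64_repaired := by
  obtain ⟨c₀, hc₀, H⟩ := LeeRaghavendraSteurer2015_thm38.cspMatrix_bound h38
  intro k P d _hmono htend ε s c hε _hs hsc hc1
  -- constants
  set ε' : ℝ := min ε 1 with hε'def
  have hε' : 0 < ε' := lt_min hε one_pos
  have hε'1 : ε' ≤ 1 := min_le_right _ _
  have hε'ε : ε' ≤ ε := min_le_left _ _
  have hcs : 0 < c - s := by linarith
  set T : ℝ := |Real.log (c₀ * ε' / 8)| +
    |3 / 2 * Real.log ε' - 3 / 2 * Real.log 2 + 1 / 2 * Real.log (c - s)| + 1 with hT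
  -- the threshold: `d(n) ≥ 24` and `log n ≥ T` beyond `n₁`
  obtain ⟨n₃, hn₃⟩ : ∃ n₃ : ℕ, ∀ n ≥ n₃, 24 ≤ d n :=
    Filter.eventually_atTop.1 (Filter.tendsto_atTop.1 htend 24)
  set n₁ : ℕ := max n₃ (⌈Real.exp T⌉₊ + 2) with hn₁
  have hn₁2 : 2 ≤ n₁ := le_trans (by omega) (le_max_right _ _)
  have hn₁pos : (0 : ℝ) < n₁ := by exact_mod_cast (by omega : 0 < n₁)
  have hn₁one : (1 : ℝ) ≤ n₁ := by exact_mod_cast (by omega : 1 ≤ n₁)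
  -- the constant `K`
  set M : ℝ := (n₁ : ℝ) ^ ((n₁ : ℝ) ^ 2 / 8) with hM
  have hM0 : 0 < M := Real.rpow_pos_of_pos hn₁pos _
  refine ⟨min 1 (1 / (2 * M)), lt_min one_pos (by positivity), ?_⟩
  intro n hn hkd hdn hfail N hN r hr
  -- `k = 0` is impossible
  rcases Nat.eq_zero_or_pos k with hk | hk
  · subst hk
    exact absurd (achievesApprox_of_arity_zero P (by linarith : s ≤ c + ε)) hfail
  have hd2 : 2 ≤ d n := by omega
  have hn2 : 2 ≤ n := le_trans hd2 hdn
  have hnR : (2 : ℝ) ≤ n := by exact_mod_cast hn2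
  -- the reduction: instance and low-degree pseudo-density
  obtain ⟨I, hI, D, hD, -, hDneg, hDbound⟩ := LeeRaghavendraSteurer2015_thm64_reduction hkd hfail
  -- `N ≥ n`
  have hNn : n ^ (4 * d n) < N := by exact_mod_cast hN
  have hnpow : n ≤ n ^ (4 * d n) := Nat.le_self_pow (by omega) n
  have hnN : n ≤ N := by omega
  by_cases hsmall : n < n₁
  · -- small `n`: the size bound forces `r = 0`
    have hpow : (n : ℝ) ^ ((d n : ℝ) ^ 2 / 8) ≤ M := by
      have hn0 : (0 : ℝ) ≤ n := Nat.cast_nonneg n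
      have hle : (n : ℝ) ≤ n₁ := by exact_mod_cast hsmall.le
      calc (n : ℝ) ^ ((d n : ℝ) ^ 2 / 8) ≤ (n₁ : ℝ) ^ ((d n : ℝ) ^ 2 / 8) :=
            Real.rpow_le_rpow hn0 hle (by positivity)
        _ ≤ (n₁ : ℝ) ^ ((n₁ : ℝ) ^ 2 / 8) := by
            refine Real.rpow_le_rpow_of_exponent_le hn₁one ?_
            have : (d n : ℝ) ≤ n₁ := by exact_mod_cast (hdn.trans hsmall.le)
            have hd0 : (0 : ℝ) ≤ d n := Nat.cast_nonneg _
            nlinarith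
    have hr1 : (r : ℝ) < 1 := by
      calc (r : ℝ) ≤ min 1 (1 / (2 * M)) * (n : ℝ) ^ ((d n : ℝ) ^ 2 / 8) := hr
        _ ≤ 1 / (2 * M) * M :=
            mul_le_mul (min_le_right _ _) hpow (by positivity) (by positivity)
        _ = 1 / 2 := by field_simp
        _ < 1 := by norm_num
    have hr0 : r = 0 := Nat.lt_one_iff.1 (by exact_mod_cast hr1)
    subst hr0
    obtain ⟨J, hJ⟩ := exists_optLE_of_le I hI hnN
    exact not_hasPsdFactorization_cspMatrix_zero J hJ hsc
  -- large `n`: Theorem 3.8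
  push Not at hsmall
  have h24 : 24 ≤ d n := hn₃ n (le_trans (le_max_left _ _) hsmall)
  have hlogn : T ≤ Real.log n := by
    have h1 : Real.exp T ≤ ⌈Real.exp T⌉₊ := Nat.le_ceil _
    have h2 : (⌈Real.exp T⌉₊ : ℝ) + 2 ≤ n₁ := by
      rw [hn₁]; exact_mod_cast le_max_right _ _
    have h3 : (n₁ : ℝ) ≤ n := by exact_mod_cast hsmall
    have : Real.exp T ≤ n := by linarith
    calc T = Real.log (Real.exp T) := (Real.log_exp T).symm
      _ ≤ Real.log n := Real.log_le_log (Real.exp_pos T) this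
  have h01 : ∀ y, 0 ≤ c - I.val y ∧ c - I.val y ≤ 1 := fun y =>
    ⟨by linarith [hI y], by linarith [I.val_nonneg y]⟩
  have hDneg' : cubeExpect (fun x => D x * (c - I.val x)) < -ε' := by linarith
  have h2nN : 2 * n ≤ N := by
    have : n ^ 2 ≤ n ^ (4 * d n) := Nat.pow_le_pow_right (by omega) (by omega)
    nlinarith
  refine H k n (d n) P c s (by omega) (by omega) I hI h01 ε' hε' hε'1 D
    (1 + (n : ℝ) ^ (2 * (d n / 2))) hD hDbound hDneg' N h2nN r ?_
  -- the size bound is below the Thm 3.8 bound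
  have hE : c - s ≤ cubeExpect (fun y => c - I.val y) := by
    rw [cubeExpect_const_sub]; linarith [cubeExpect_le_of_forall_le hI]
  have hn1R : (1 : ℝ) ≤ n := by linarith
  have hB1 : (1 : ℝ) ≤ 1 + (n : ℝ) ^ (2 * (d n / 2)) := by
    have : (0 : ℝ) ≤ (n : ℝ) ^ (2 * (d n / 2)) := by positivity
    linarith
  have hB : 1 + (n : ℝ) ^ (2 * (d n / 2)) ≤ 2 * (n : ℝ) ^ ((d n : ℕ) : ℝ) := by
    rw [Real.rpow_natCast]
    have h1 : (n : ℝ) ^ (2 * (d n / 2)) ≤ (n : ℝ) ^ (d n) :=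
      pow_le_pow_right₀ hn1R (by omega)
    have h2 : (1 : ℝ) ≤ (n : ℝ) ^ (d n) := one_le_pow₀ hn1R
    linarith
  have hNR : (n : ℝ) ^ (4 * ((d n : ℕ) : ℝ)) ≤ N := by
    have : (n : ℝ) ^ (4 * ((d n : ℕ) : ℝ)) = (n : ℝ) ^ (4 * d n) := by
      rw [show (4 : ℝ) * ((d n : ℕ) : ℝ) = ((4 * d n : ℕ) : ℝ) by push_cast; ring, Real.rpow_natCast]
    rw [this]; exact hN.le
  have hbound := thm38_bound_ge (N := (N : ℝ)) (n := (n : ℝ)) (d := ((d n : ℕ) : ℝ)) hc₀ hε' hcs hE hnR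
    (by exact_mod_cast h24) (by exact_mod_cast hdn) hB1 hB hNR hlogn
  have hX : (0 : ℝ) < (n : ℝ) ^ (((d n : ℕ) : ℝ) ^ 2 / 8) := by positivity
  calc (r : ℝ) ≤ min 1 (1 / (2 * M)) * (n : ℝ) ^ (((d n : ℕ) : ℝ) ^ 2 / 8) := hr
    _ ≤ 1 * (n : ℝ) ^ (((d n : ℕ) : ℝ) ^ 2 / 8) :=
        mul_le_mul_of_nonneg_right (min_le_left _ _) hX.le
    _ < 2 * (n : ℝ) ^ (((d n : ℕ) : ℝ) ^ 2 / 8) := by linarith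
    _ ≤ _ := hbound


/-! ### Theorem 1.6 from Theorem 3.8 (§6.2, proof of Theorem 6.2) -/

/-- Positive scaling of the entries preserves psd factorisations of a given size (`A_i ↦ a A_i`).
[cite: LeeRaghavendraSteurer2015, Def. 1.7 (p. 7)] -/
theorem HasPsdFactorization.const_mul {ι κ : Type*} {M : ι → κ → ℝ} {r : ℕ}
    (h : HasPsdFactorization M r) {a : ℝ} (ha : 0 ≤ a) :
    HasPsdFactorization (fun i j => a * M i j) r := by
  obtain ⟨A, B, hA, hB, hM⟩ := h
  refine ⟨fun i => a • A i, B, fun i => (hA i).smul ha, hB, fun i j => ?_⟩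
  show a * M i j = _
  rw [Matrix.smul_mul, Matrix.trace_smul, smul_eq_mul, hM i j]

/-- A nonnegative CONSTANT has a sum-of-squares certificate of every degree (the square of a
constant). [cite: LeeRaghavendraSteurer2015, §1 (sos certificates)] -/
theorem hasSosCertificate_const {m : ℕ} (d : ℕ) {a : ℝ} (ha : 0 ≤ a) :
    HasSosCertificate d (fun _ : Fin m → Bool => a) :=
  ⟨1, fun _ _ => Real.sqrt a, fun _ => HasDegreeLE.const _ _, fun x => by
    rw [Fin.sum_univ_one, Real.sq_sqrt ha]⟩

/-- **Lee–Raghavendra–Steurer 2015, Theorem 1.6 DERIVED from Theorem 3.8** (the proof of Thm 6.2,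
§6.2 p. 25, with Prop. 1.13 in place of Prop. 6.1): if the degree-`≤ d` functions on `{0,1}^m` fail
to achieve a `(c,s)`-approximation for Max-`𝒫_m`, then (i) either some instance with `opt ≤ s` has a
value above `c`, and then every subspace fails on its plantings, or (ii) `c − ℑ₀ ∈ [0, c]` has no
degree-`2d` certificate, the §2 duality gives a degree-`2d` pseudo-density `D` with `E D (c − ℑ₀) < 0`,
Prop. 1.13 turns an achieving `U` on `n` variables into a psd factorisation of `M^{n,Π}_{c,s}` of size
`dim U`, hence (planting, rescaling by `1/c`) of the pattern matrix `M_n^f`, `f = (c − ℑ₀)/c ∈ [0,1]`,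
and Thm 3.8 bounds its size below by `C (n/log n)^{d/2} ≥ 2α (n/log n)^{d/4}`.
[cite: LeeRaghavendraSteurer2015, Thm 1.6 (p. 6) and Thm 6.2 proof (p. 25)] -/
theorem LeeRaghavendraSteurer2015_thm16_of_thm38 (h38 : LeeRaghavendraSteurer2015_thm38) :
    LeeRaghavendraSteurer2015_thm16 := by
  obtain ⟨c₀, hc₀, H38⟩ := h38
  intro k P c s m d hfail
  simp only [AchievesApprox, not_forall, exists_prop] at hfail
  obtain ⟨I₀, hI₀, hnot⟩ := hfail
  -- evaluation of a planted instance at an extended assignment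
  have hplant : ∀ {n : ℕ} (hmn : m ≤ n) (x : Fin m → Bool),
      (I₀.plant (Fin.castLEEmb hmn)).val (Function.extend (Fin.castLEEmb hmn) x fun _ => false) =
        I₀.val x := by
    intro n hmn x
    rw [CSPInstance.plant_val]
    congr 1
    funext i
    exact (Fin.castLEEmb hmn).injective.extend_apply _ _ i
  by_cases hA : ∃ x, c < I₀.val x
  · -- (i) a value above `c`: every subspace fails on the planted instance
    obtain ⟨x₀, hx₀⟩ := hA
    refine ⟨1, one_pos, m, fun n hn U _ hU => ?_⟩
    obtain ⟨t, g, -, hsum⟩ := hU (I₀.plant (Fin.castLEEmb hn)) (hI₀.plant _)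
    have h1 := hsum (Function.extend (Fin.castLEEmb hn) x₀ fun _ => false)
    rw [hplant hn x₀] at h1
    have h2 : (0 : ℝ) ≤ ∑ i, g i (Function.extend (Fin.castLEEmb hn) x₀ fun _ => false) ^ 2 :=
      sum_nonneg fun i _ => sq_nonneg _
    linarith
  push Not at hA
  -- (ii) `0 ≤ c − ℑ₀ ≤ c`; no degree-`2d` certificate
  have hnot' : ¬ HasSosCertificate (2 * d) (fun x => c - I₀.val x) := by
    rw [← subspaceSos_degreeLE_iff, Nat.mul_div_cancel_left d two_pos]
    exact hnot
  -- `c − ℑ₀` is not constant-and-nonnegative, in particular not `≡ 0`; hence `c > 0`, `m ≥ 1`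
  have hnonconst : ¬ ∀ x y, I₀.val x = I₀.val y := by
    intro hconst
    apply hnot'
    have : (fun x => c - I₀.val x) = fun _ => c - I₀.val (fun _ => false) := by
      funext x; rw [hconst x]
    rw [this]
    exact hasSosCertificate_const _ (sub_nonneg.2 (hA _))
  have hm : 1 ≤ m := by
    rcases Nat.eq_zero_or_pos m with hm0 | hm0
    · exfalso
      subst hm0
      exact hnonconst fun x y => by rw [Subsingleton.elim x y]
    · exact hm0
  have hc : 0 < c := by
    by_contra hc0
    push Not at hc0
    apply hnonconst
    intro x y
    have hx := I₀.val_nonneg x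
    have hy := I₀.val_nonneg y
    have hx' := hA x
    have hy' := hA y
    linarith
  -- the normalised function `f = (c − ℑ₀)/c ∈ [0,1]`
  set f : (Fin m → Bool) → ℝ := fun x => c⁻¹ * (c - I₀.val x) with hf
  have hf01 : ∀ x, 0 ≤ f x ∧ f x ≤ 1 := by
    intro x
    have h1 := hA x
    have h2 := I₀.val_nonneg x
    refine ⟨mul_nonneg (inv_nonneg.2 hc.le) (sub_nonneg.2 h1), ?_⟩
    rw [hf]
    dsimp only
    rw [inv_mul_le_iff₀ hc]
    linarith
  -- the §2 duality: a degree-`2d` pseudo-density negative on `c − ℑ₀`, hence on `f`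
  obtain ⟨D, hD, hDneg⟩ := (not_hasSosCertificate_iff_exists_pseudoDensity _).1 hnot'
  have hDf : cubeExpect (fun x => D x * f x) = c⁻¹ * cubeExpect (fun x => D x * (c - I₀.val x)) := by
    rw [← cubeExpect_const_mul]
    congr 1
    funext x
    rw [hf]
    ring
  have hDf_neg : cubeExpect (fun x => D x * f x) < 0 := by
    rw [hDf]; exact mul_neg_of_pos_of_neg (inv_pos.2 hc) hDneg
  -- the case `d = 0`: `dim U < 1` forces `U = ⊥`, which certifies only `c − ℑ ≡ 0`
  rcases Nat.eq_zero_or_pos d with hd0 | hd0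
  · subst hd0
    refine ⟨1 / 2, by norm_num, m, fun n hn U hUdim hU => ?_⟩
    have hU0 : Module.finrank ℝ U = 0 := by
      have : (Module.finrank ℝ U : ℝ) < 1 := by
        calc (Module.finrank ℝ U : ℝ) ≤ 1 / 2 * ((n : ℝ) / Real.log n) ^ ((0 : ℕ) / 4 : ℝ) := hUdim
          _ = 1 / 2 := by simp
          _ < 1 := by norm_num
      exact Nat.lt_one_iff.1 (by exact_mod_cast this)
    have hUbot : U = ⊥ := Submodule.finrank_eq_zero.1 hU0
    obtain ⟨t, g, hg, hsum⟩ := hU (I₀.plant (Fin.castLEEmb hn)) (hI₀.plant _)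
    have hg0 : ∀ i, g i = 0 := fun i => by
      have := hg i
      rw [hUbot] at this
      exact (Submodule.mem_bot ℝ).1 this
    apply hnonconst
    intro x y
    have hx := hsum (Function.extend (Fin.castLEEmb hn) x fun _ => false)
    have hy := hsum (Function.extend (Fin.castLEEmb hn) y fun _ => false)
    rw [hplant hn] at hx hy
    simp only [hg0, Pi.zero_apply] at hx hy
    simp at hx hy
    linarith
  -- main case `d ≥ 1`, `m ≥ 1`: Theorem 3.8 for `f` with the degree-`2d` pseudo-density `D`
  have hEf_pos : 0 < cubeExpect f := by
    -- `f ≥ 0` and not identically zero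
    have hnn : ∀ x, 0 ≤ f x := fun x => (hf01 x).1
    rcases (cubeExpect_nonneg hnn).eq_or_lt with h0 | hpos
    · exfalso
      apply hnonconst
      -- `E f = 0` with `f ≥ 0` forces `f ≡ 0`
      have hzero : ∀ x, f x = 0 := by
        intro x
        have hsum0 : ∑ y, f y = 0 := by
          unfold cubeExpect at h0
          have h2 : (2 : ℝ) ^ m ≠ 0 := pow_ne_zero _ two_ne_zero
          field_simp at h0
          linarith
        exact (sum_eq_zero_iff_of_nonneg (fun y _ => hnn y)).1 hsum0 x (mem_univ x)
      intro x y
      have hx := hzero x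
      have hy := hzero y
      rw [hf] at hx hy
      dsimp only at hx hy
      have hcne : c⁻¹ ≠ 0 := inv_ne_zero hc.ne'
      have hx' := (mul_eq_zero.1 hx).resolve_left hcne
      have hy' := (mul_eq_zero.1 hy).resolve_left hcne
      linarith
    · exact hpos
  set ε : ℝ := min 1 (-cubeExpect (fun x => D x * f x) / 2) with hε
  have hε0 : 0 < ε := lt_min one_pos (by linarith)
  have hε1 : ε ≤ 1 := min_le_left _ _
  have hDfε : cubeExpect (fun x => D x * f x) < -ε := by
    have : ε ≤ -cubeExpect (fun x => D x * f x) / 2 := min_le_right _ _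
    linarith
  set K : ℝ := 1 + ∑ x, |D x| with hK
  have hK0 : 0 < K := by rw [hK]; positivity
  have hKD : ∀ x, |D x| ≤ K := fun x => by
    rw [hK]
    have := Finset.single_le_sum (f := fun y => |D y|) (fun y _ => abs_nonneg _) (mem_univ x)
    linarith
  -- Theorem 3.8: for `n ≥ 2m`, no psd factorisation of `M_n^f` of size `< Ψ(n)`
  have H := H38 m (2 * d) hm (by omega) f hf01 ε hε0 hε1 D K hD hKD hDfε
  -- the constants: `Ψ(n) = A₁^{d/2} (n / log n)^{d/2} A₂`
  set A₁ : ℝ := c₀ * ε / ((2 * d : ℕ) * (m : ℝ) ^ 2 * K) with hA₁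
  set A₂ : ℝ := (ε / K) ^ ((3 : ℝ) / 2) * Real.sqrt (cubeExpect f) with hA₂
  have hA₁0 : 0 < A₁ := by rw [hA₁]; positivity
  have hA₂0 : 0 < A₂ := by
    rw [hA₂]; exact mul_pos (Real.rpow_pos_of_pos (div_pos hε0 hK0) _) (Real.sqrt_pos.2 hEf_pos)
  refine ⟨A₁ ^ ((d : ℝ) / 2) * A₂ / 2, by positivity, 2 * m, fun n hn U hUdim hU => ?_⟩
  -- an achieving `U` gives a factorisation of `M^{n,Π}_{c,s}`, hence of `M_n^f`, of size `dim U`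
  have hfac : HasPsdFactorization (patternMatrix n f) (Module.finrank ℝ U) := by
    have h1 := (AchievesApprox.hasPsdFactorization U hU).patternMatrix_of_cspMatrix I₀ hI₀
    have h2 := h1.const_mul (inv_nonneg.2 hc.le)
    convert h2 using 1
    funext S x
    simp only [patternMatrix_apply, hf]
  refine H n hn (Module.finrank ℝ U) ?_ hfac
  -- `dim U ≤ α (n/log n)^{d/4} < Ψ(n)`
  have hn2 : (2 : ℝ) ≤ n := by exact_mod_cast (le_trans (by omega : 2 ≤ 2 * m) hn)
  have hlogn : 0 < Real.log n := Real.log_pos (by linarith)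
  have hX1 : 1 ≤ (n : ℝ) / Real.log n := by
    rw [le_div_iff₀ hlogn, one_mul]
    have := Real.log_le_sub_one_of_pos (by linarith : (0 : ℝ) < n)
    linarith
  have hX0 : 0 ≤ (n : ℝ) / Real.log n := by linarith
  have hΨ : (c₀ * ε * n / ((2 * d : ℕ) * (m : ℝ) ^ 2 * K * Real.log n)) ^ (((2 * d : ℕ) : ℝ) / 4) *
      (ε / K) ^ ((3 : ℝ) / 2) * Real.sqrt (cubeExpect f) =
      A₁ ^ ((d : ℝ) / 2) * ((n : ℝ) / Real.log n) ^ ((d : ℝ) / 2) * A₂ := by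
    have hexp : (((2 * d : ℕ) : ℝ) / 4) = (d : ℝ) / 2 := by push_cast; ring
    have hbase : c₀ * ε * n / ((2 * d : ℕ) * (m : ℝ) ^ 2 * K * Real.log n) =
        A₁ * ((n : ℝ) / Real.log n) := by
      rw [hA₁]
      field_simp
    rw [hexp, hbase, Real.mul_rpow hA₁0.le hX0, hA₂]
    ring
  rw [hΨ]
  have hmono : ((n : ℝ) / Real.log n) ^ ((d : ℝ) / 4) ≤ ((n : ℝ) / Real.log n) ^ ((d : ℝ) / 2) :=
    Real.rpow_le_rpow_of_exponent_le hX1 (by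
      have : (0 : ℝ) ≤ d := Nat.cast_nonneg d
      linarith)
  have hpos : 0 < A₁ ^ ((d : ℝ) / 2) * ((n : ℝ) / Real.log n) ^ ((d : ℝ) / 2) * A₂ := by
    have := Real.rpow_pos_of_pos (lt_of_lt_of_le one_pos hX1) ((d : ℝ) / 2)
    positivity
  calc (Module.finrank ℝ U : ℝ) ≤ A₁ ^ ((d : ℝ) / 2) * A₂ / 2 * ((n : ℝ) / Real.log n) ^ ((d : ℝ) / 4) :=
        hUdim
    _ ≤ A₁ ^ ((d : ℝ) / 2) * A₂ / 2 * ((n : ℝ) / Real.log n) ^ ((d : ℝ) / 2) :=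
        mul_le_mul_of_nonneg_left hmono (by positivity)
    _ < A₁ ^ ((d : ℝ) / 2) * ((n : ℝ) / Real.log n) ^ ((d : ℝ) / 2) * A₂ := by linarith


end Literature.Combinatorics.Optimization

end
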